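import Literature.Analysis.DeBrangesSpaces.DeBranges1986Positivity
import Mathlib.Analysis.Complex.Liouville
import Mathlib.Analysis.Complex.CauchyIntegral
import Mathlib.Analysis.Analytic.IsolatedZeros
import Mathlib.Analysis.SpecialFunctions.NonIntegrable
import HarnessLib

/-!
# de Branges 1986, the strict remark (p. 16 l. 17–20) as printed is false: a degenerate example

LABEL: RH-FREE — NEGATIVE KNOWLEDGE about one printed sentence concerning a GENERAL structure
function; no statement about `ζ` or RH; nothing here bears on the truth of RH. bears_on: B-C/B-P
(COLUMN 6 DBR) bookkeeping only.

The named fact `deBranges1986_strictRemark` (`DeBranges1986Positivity.lean`) types de Branges'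
sentence (Bull. AMS 15 (1986), p. 16 l. 17–20, stated there WITHOUT proof): under the standing
hypotheses of Theorem 6 (`𝓗(E)` given, `E(z − i)` and `E♯(z)` linearly dependent), "if the
stronger hypothesis is made that the real part of `(F(t + i), F(t))` is positive whenever `F(z)`
is a nonzero element of the space such that `F(z + i)` belongs to the space, then `E(z)` has no
zero `w` such that `w` or `w + i` is real or such that `E(w + i) = E(w − i)`."

Taken literally this is FALSE in degenerate cases, and we record the counterexample
`E₀(z) = z (z + i)` (one of the polynomial examples of de Branges' own remark p. 14 l. 26–32):
* `E₀` is a structure function (`|E₀(z̄)| < |E₀(z)|` on `Im z > 0`) with `E₀♯ = E₀(· − i)`;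
* `K(z, z) = ‖z‖²/π`, so the kernel bound forces every element of `𝓗(E₀)` (membership as on
  p. 3 = Conrey–Li (2.1)) to be `a z` (Liouville), and `F(· + i) ∈ 𝓗(E₀)` forces `a = 0`
  (`a(x + i)/E₀(x) = a/x` is not square integrable at `0`): the shift domain is `{0}`;
* hence the strict positivity condition holds VACUOUSLY, while `E₀(0) = 0` is a real zero (and
  `−i` a zero with `−i + i` real): `deBranges1986_strictRemark_false`.

What survives (proved in `DeBranges1986PositivityProofs.lean` / `…Holds.lean`): strict
positivity DOES exclude the zeros with `w, w + i ∉ ℝ` and `E(w + i) = E(w − i)`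
(`apply_add_I_ne_of_shiftPos`, every structure function), and the whole remark holds for
structure functions without real zeros (`deBranges1986_strictRemark_of_noRealZeros`). de Branges
presumably has a non-degenerate shift domain in mind; the printed sentence carries no such
hypothesis, so the typed fact is retired by refutation (house precedent:
`Suzuki2021_prop41_fourier_false`). Nobody should take `(h : deBranges1986_strictRemark)`.

## References

* L. de Branges, Bull. AMS 15 (1986) 1–17, p. 14 l. 26–32, p. 16 l. 17–20 (read) [deBranges1986].
-/

noncomputable section

open scoped Real Topology ComplexConjugate
open _root_.Complex _root_.MeasureTheory _root_.Filter _root_.Set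

namespace Literature.Analysis.DeBrangesSpaces

open DeBranges1986

/-! ### The counterexample `E₀(z) = z (z + i)` -/

/-- The counterexample structure function `E₀(z) = z (z + i)` is entire. [folklore] -/
private theorem differentiable_witness : Differentiable ℂ (fun z : ℂ => z * (z + I)) :=
  differentiable_id.mul (differentiable_id.add_const I)

/-- `‖z̄ + i‖² + 4 Im z = ‖z + i‖²`. [folklore] -/
private theorem normSq_conj_add_I (z : ℂ) : ‖conj z + I‖ ^ 2 + 4 * z.im = ‖z + I‖ ^ 2 := by
  rw [Complex.sq_norm, Complex.sq_norm, Complex.normSq_apply, Complex.normSq_apply]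
  simp only [add_re, conj_re, I_re, add_zero, add_im, conj_im, I_im]
  ring

/-- `E₀` is a de Branges structure function: `|E₀(z̄)| < |E₀(z)|` for `Im z > 0`.
[cite: deBranges1986, p. 14] -/
theorem isHermiteBiehler_mul_add_I : IsHermiteBiehler (fun z : ℂ => z * (z + I)) := by
  refine ⟨differentiable_witness, fun z hz => ?_⟩
  have hz0 : z ≠ 0 := by
    rintro rfl
    simp at hz
  simp only [norm_mul, Complex.norm_conj]
  refine mul_lt_mul_of_pos_left ?_ (norm_pos_iff.2 hz0)
  have h := normSq_conj_add_I z
  have h1 : ‖conj z + I‖ ^ 2 < ‖z + I‖ ^ 2 := by linarith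
  exact lt_of_pow_lt_pow_left₀ 2 (norm_nonneg _) h1

/-- `E₀♯(z) = E₀(z − i)`: the linear-dependence hypothesis holds (with `ε = 1`).
[cite: deBranges1986, p. 14] -/
theorem shiftLinDep_mul_add_I : ShiftLinDep (fun z : ℂ => z * (z + I)) := by
  refine shiftLinDep_of_sharp_eq (ε := 1) fun z => ?_
  simp only [sharp_apply, map_mul, map_add, Complex.conj_conj, Complex.conj_I]
  ring

/-- The kernel diagonal of `E₀`: `K(z, z) = ‖z‖²/π` off the real axis. [folklore] -/
private theorem deBrangesKernelDiag_witness {z : ℂ} (hz : z.im ≠ 0) :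
    deBrangesKernelDiag (fun z : ℂ => z * (z + I)) z = ‖z‖ ^ 2 / π := by
  unfold deBrangesKernelDiag
  simp only [norm_mul, Complex.norm_conj, mul_pow]
  have h := normSq_conj_add_I z
  have hπ : (π : ℝ) ≠ 0 := Real.pi_ne_zero
  rw [div_eq_div_iff (by positivity) hπ]
  linear_combination (-(π * ‖z‖ ^ 2)) * h

/-- Bounds off the real axis persist on it: if `F`, `b` are continuous and `‖F z‖ ≤ b z` for
`Im z ≠ 0`, then `‖F z‖ ≤ b z` everywhere. [folklore] -/
private theorem norm_le_of_off_real {F : ℂ → ℂ} (hF : Continuous F) {b : ℂ → ℝ}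
    (hb : Continuous b) (h : ∀ z : ℂ, z.im ≠ 0 → ‖F z‖ ≤ b z) (z : ℂ) : ‖F z‖ ≤ b z := by
  by_cases hz : z.im ≠ 0
  · exact h z hz
  push Not at hz
  have hpath : Tendsto (fun y : ℝ => z + y * I) (𝓝[>] 0) (𝓝 z) := by
    have hc : Continuous (fun y : ℝ => z + y * I) := by fun_prop
    have := hc.tendsto 0
    simp only [Complex.ofReal_zero, zero_mul, add_zero] at this
    exact this.mono_left nhdsWithin_le_nhds
  have h1 : Tendsto (fun y : ℝ => ‖F (z + y * I)‖) (𝓝[>] 0) (𝓝 ‖F z‖) :=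
    ((continuous_norm.comp hF).tendsto z).comp hpath
  have h2 : Tendsto (fun y : ℝ => b (z + y * I)) (𝓝[>] 0) (𝓝 (b z)) :=
    (hb.tendsto z).comp hpath
  refine le_of_tendsto_of_tendsto h1 h2 ?_
  filter_upwards [self_mem_nhdsWithin] with y hy
  apply h
  have : (z + (y : ℂ) * I).im = y := by simp [hz]
  rw [this]
  exact (ne_of_lt hy).symm

/-- An element of `𝓗(E₀)` (de Branges p. 3 / Conrey–Li (2.1) membership) is a multiple of `z`:
the kernel bound reads `|F(z)|² ≤ ‖F‖² ‖z‖²/π`, so `F(0) = 0` and `F(z)/z` is a bounded entire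
function (Liouville). [cite: deBranges1986, p. 3] -/
theorem exists_eq_mul_of_mem_mul_add_I {F : ℂ → ℂ} (hF : Mem (fun z : ℂ => z * (z + I)) F) :
    ∃ a : ℂ, ∀ z : ℂ, F z = a * z := by
  obtain ⟨hFd, -, hkb⟩ := hF
  set N : ℝ := deBrangesNormSq (fun z : ℂ => z * (z + I)) F with hN
  have hN0 : 0 ≤ N := deBrangesNormSq_nonneg _ F
  set C : ℝ := √(N / π) with hC
  have hC0 : 0 ≤ C := Real.sqrt_nonneg _
  -- `‖F z‖ ≤ C ‖z‖` off the real axis, hence everywhere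
  have hoff : ∀ z : ℂ, z.im ≠ 0 → ‖F z‖ ≤ C * ‖z‖ := by
    intro z hz
    have h := hkb z hz
    rw [deBrangesKernelDiag_witness hz] at h
    have h2 : ‖F z‖ ^ 2 ≤ (C * ‖z‖) ^ 2 := by
      rw [mul_pow, hC, Real.sq_sqrt (by positivity)]
      calc ‖F z‖ ^ 2 ≤ N * (‖z‖ ^ 2 / π) := h
        _ = N / π * ‖z‖ ^ 2 := by ring
    exact le_of_pow_le_pow_left₀ two_ne_zero (by positivity) h2
  have hall : ∀ z : ℂ, ‖F z‖ ≤ C * ‖z‖ :=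
    norm_le_of_off_real hFd.continuous (continuous_const.mul continuous_norm) hoff
  have hF0 : F 0 = 0 := by
    have := hall 0
    simp only [norm_zero, mul_zero] at this
    exact norm_le_zero_iff.1 this
  -- `g = F(z)/z`, entire and bounded
  set g : ℂ → ℂ := dslope F 0 with hg
  have hgd : Differentiable ℂ g := by
    intro z
    by_cases hz : z = 0
    · subst hz
      obtain ⟨p, hp⟩ := hFd.analyticAt (0 : ℂ)
      exact hp.has_fpower_series_dslope_fslope.analyticAt.differentiableAt
    · exact (differentiableAt_dslope_of_ne hz).2 (hFd z)
  have hgz : ∀ z : ℂ, z ≠ 0 → g z = F z / z := by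
    intro z hz
    rw [hg, dslope_of_ne _ hz, slope_def_field, hF0, sub_zero, sub_zero]
  have hgb : ∀ z : ℂ, ‖g z‖ ≤ C := by
    refine norm_le_of_off_real hgd.continuous continuous_const fun z hz => ?_
    have hz0 : z ≠ 0 := by
      rintro rfl
      simp at hz
    rw [hgz z hz0, norm_div, div_le_iff₀ (norm_pos_iff.2 hz0)]
    exact hall z
  have hconst := hgd.apply_eq_apply_of_bounded
    (isBounded_iff_forall_norm_le.2 ⟨C, by rintro _ ⟨z, rfl⟩; exact hgb z⟩)
  refine ⟨g 0, fun z => ?_⟩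
  by_cases hz : z = 0
  · rw [hz, hF0, mul_zero]
  · rw [← hconst z 0, hgz z hz, div_mul_cancel₀ _ hz]

/-- **The shift domain of `𝓗(E₀)` is trivial**: if `F` and `F(· + i)` both belong to `𝓗(E₀)`
then `F = 0` (`F = a z` and `F(x + i)/E₀(x) = a/x` is square integrable near `0` only for
`a = 0`). Hence the strict positivity condition holds VACUOUSLY for `E₀`. [cite: deBranges1986,
p. 16] -/
theorem eq_zero_of_shiftMem_mul_add_I {F : ℂ → ℂ} (hF : ShiftMem (fun z : ℂ => z * (z + I)) F) :
    F = 0 := by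
  obtain ⟨a, ha⟩ := exists_eq_mul_of_mem_mul_add_I hF.1
  have hint : Integrable fun x : ℝ => ‖F (x + I) / (fun z : ℂ => z * (z + I)) x‖ ^ 2 :=
    hF.2.integrable_sq
  by_cases ha0 : a = 0
  · funext z
    rw [ha z, ha0, zero_mul, Pi.zero_apply]
  exfalso
  -- `‖F(x + i)/E₀(x)‖² = ‖a‖²/x²` for `x ≠ 0`
  have hval : ∀ x : ℝ, x ≠ 0 → ‖F (x + I) / (fun z : ℂ => z * (z + I)) x‖ ^ 2 = ‖a‖ ^ 2 / x ^ 2 := by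
    intro x hx
    have hx' : (x : ℂ) ≠ 0 := by exact_mod_cast hx
    have hxI : (x : ℂ) + I ≠ 0 := by
      intro h
      have := congrArg Complex.im h
      simp at this
    rw [ha, show a * ((x : ℂ) + I) / ((x : ℂ) * ((x : ℂ) + I)) = a / x by
      field_simp, norm_div, Complex.norm_real, Real.norm_eq_abs, div_pow, sq_abs]
  have hbig : ∀ᶠ x : ℝ in 𝓝[≠] 0, ‖(x - 0)⁻¹‖ ≤
      (‖a‖ ^ 2)⁻¹ * ‖‖F (x + I) / (fun z : ℂ => z * (z + I)) x‖ ^ 2‖ := by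
    have hIcc : ∀ᶠ x : ℝ in 𝓝 (0 : ℝ), |x| ≤ 1 := by
      have : Icc (-1 : ℝ) 1 ∈ 𝓝 (0 : ℝ) := Icc_mem_nhds (by norm_num) (by norm_num)
      filter_upwards [this] with x hx
      exact abs_le.2 ⟨hx.1, hx.2⟩
    filter_upwards [self_mem_nhdsWithin, hIcc.filter_mono nhdsWithin_le_nhds] with x hx hx1
    have hx : x ≠ 0 := hx
    rw [sub_zero, hval x hx, norm_inv, Real.norm_eq_abs,
      Real.norm_of_nonneg (div_nonneg (sq_nonneg _) (sq_nonneg _))]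
    have ha2 : 0 < ‖a‖ ^ 2 := pow_pos (norm_pos_iff.2 ha0) 2
    have hxpos : 0 < |x| := abs_pos.2 hx
    rw [show (‖a‖ ^ 2)⁻¹ * (‖a‖ ^ 2 / x ^ 2) = (x ^ 2)⁻¹ by field_simp, ← sq_abs,
      inv_le_inv₀ hxpos (pow_pos hxpos 2)]
    nlinarith
  have hO : (fun x : ℝ => (x - 0)⁻¹) =O[𝓝[≠] (0 : ℝ)]
      fun x : ℝ => ‖F (x + I) / (fun z : ℂ => z * (z + I)) x‖ ^ 2 :=
    Asymptotics.IsBigO.of_bound _ hbig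
  exact not_intervalIntegrable_of_sub_inv_isBigO_punctured hO (a := -1) (b := 1) (by norm_num)
    (Set.mem_uIcc.2 (Or.inl ⟨by norm_num, by norm_num⟩)) hint.intervalIntegrable

/-- **de Branges' strict remark (p. 16, l. 17–20), AS PRINTED, is false**: for
`E₀(z) = z(z + i)` the hypotheses of Theorem 6 hold (`E₀` is a structure function, `E₀♯ = E₀(· − i)`)
and the strict positivity condition holds vacuously (the shift domain is `{0}`), yet `E₀` has
the real zero `0` (and the zero `−i` with `−i + i` real). What IS true: strict positivity
excludes the zeros with `w, w + i ∉ ℝ` and `E(w + i) = E(w − i)`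
(`apply_add_I_ne_of_shiftPos_of_isHermiteBiehler`), and the whole remark holds for structure
functions without real zeros (`deBranges1986_strictRemark_of_noRealZeros`). Negative knowledge
about a printed sentence; nobody should take `(h : deBranges1986_strictRemark)`.
[cite: deBranges1986, p. 16] -/
theorem deBranges1986_strictRemark_false : ¬ deBranges1986_strictRemark := by
  intro h
  have hpos : ShiftPos (fun z : ℂ => z * (z + I)) := fun F hF hF0 =>
    absurd (eq_zero_of_shiftMem_mul_add_I hF) hF0
  have hw : IsAdmissibleZero (fun z : ℂ => z * (z + I)) 0 :=
    h (fun z : ℂ => z * (z + I)) isHermiteBiehler_mul_add_I shiftLinDep_mul_add_I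
      hpos 0 (by simp)
  exact hw.2.1 (by simp)

end Literature.Analysis.DeBrangesSpaces

end
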